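import Summits.AtomisticToContinuum.Crystallization.Theses.GappedShellCensus
import Literature.Geometry.DiscreteGeometry.ShellCensusFrame
import Literature.Geometry.DiscreteGeometry.LayerShells

/-!
# Crux `GappedShellCensus.ShellTrichotomy` (stmt-AtomisticToContinuum-18070), line `Sketch` —
# stub `stub_commonNbrLeTwo` (a bond has at most two common bonded neighbours)

Setting: the census half of the shell trichotomy.  Five points `p q x y z` of `ℝ³` with norms in
the bond window `[0.98, 1.02]`, `0pq` a bond triangle, each of `x, y, z` bonded to both `p` and
`q`, and `x, y, z` pairwise `≥ 0.98` apart.  Claim: impossible.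

Proof (elementary coordinates, no cross products).  By the tree's frame normalisation
(`ShellCensus.exists_frame`, three reflections) we may assume `p = (0, 0, ‖p‖)`,
`q = (q₀, 0, q₂)` with `q₀ ≥ 0` and `x₁ ≥ 0`; norms, distances and inner products are invariant
under the linear isometry.  The bond windows become inner-product windows
`⟪u, w⟫ ∈ [0.4402, 0.5602]` (`inner_window`), which pin, for every `w ∈ {x, y, z}`, the
coordinates `w₂ ∈ [0.43, 0.572]`, `w₀ ∈ [0.12, 0.48]`, `w₁² ∈ [0.4, 0.85]` (`coord_bounds`): the
common neighbours of the bond live in two small blobs on either side of the plane `{w₁ = 0}`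
spanned by `p, q`, and the SIGN of `w₁` is the side.  Two of `x₁, y₁, z₁` have the same sign
(pigeonhole, `x₁ ≥ 0` from the frame halves the case split), and two same-side points are within
`√0.24 < 0.98` of each other (`same_side`), contradicting their separation.  All interval
arithmetic is exact rational arithmetic discharged by `nlinarith` / `linarith`; the margins are
large (`0.24` against `0.9604`).  Imports: the Theses file, the frame lemma and the coordinate
formulas `inner_fin3` / `norm_sq_fin3` / `dist_sq_fin3` of `LayerShells`; no named fact, no
definition.
-/

noncomputable section

namespace Summit.AtomisticToContinuum.Crystallization.Theorems

open scoped RealInnerProductSpace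
open Literature.Geometry.DiscreteGeometry

/-- A length in the bond window `[0.98, 1.02]` has its square in `[0.9604, 1.0404]`. [folklore] -/
private theorem sq_window {a : ℝ} (h : 1 - 1 / 50 ≤ a ∧ a ≤ 1 + 1 / 50) :
    2401 / 2500 ≤ a ^ 2 ∧ a ^ 2 ≤ 2601 / 2500 := by
  obtain ⟨h1, h2⟩ := h
  constructor <;> nlinarith

/-- **Bond windows as inner-product windows.** If `‖u‖, ‖w‖, ‖u - w‖ ∈ [0.98, 1.02]` then
`⟪u, w⟫ = (‖u‖² + ‖w‖² − ‖u − w‖²) / 2 ∈ [0.4402, 0.5602]`. [folklore] -/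
private theorem inner_window {u w : EuclideanSpace ℝ (Fin 3)}
    (hu : 1 - 1 / 50 ≤ ‖u‖ ∧ ‖u‖ ≤ 1 + 1 / 50) (hw : 1 - 1 / 50 ≤ ‖w‖ ∧ ‖w‖ ≤ 1 + 1 / 50)
    (huw : 1 - 1 / 50 ≤ dist u w ∧ dist u w ≤ 1 + 1 / 50) :
    2201 / 5000 ≤ ⟪u, w⟫ ∧ ⟪u, w⟫ ≤ 2801 / 5000 := by
  have h := norm_sub_sq_real u w
  rw [← dist_eq_norm] at h
  have h1 := sq_window hu
  have h2 := sq_window hw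
  have h3 := sq_window huw
  constructor <;> linarith [h1.1, h1.2, h2.1, h2.2, h3.1, h3.2]

/-- **Frame bounds.** In the frame `p = (0, 0, p₂)`, `q = (q₀, 0, q₂)`, `q₀ ≥ 0`, the windows
`p₂ ∈ [0.98, 1.02]`, `⟪p, q⟫ = p₂ q₂ ∈ [0.4402, 0.5602]`, `‖q‖² = q₀² + q₂² ∈ [0.9604, 1.0404]`
pin `q₂ ∈ [0.43, 0.572]` and `q₀ ∈ [0.79, 0.925]`. [folklore] -/
private theorem frame_bounds {p₂ q₀ q₁ q₂ : ℝ} (hp : 1 - 1 / 50 ≤ p₂ ∧ p₂ ≤ 1 + 1 / 50)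
    (hq0 : 0 ≤ q₀) (hq1 : q₁ = 0)
    (hpq : 2201 / 5000 ≤ p₂ * q₂ ∧ p₂ * q₂ ≤ 2801 / 5000)
    (hqq : 2401 / 2500 ≤ q₀ ^ 2 + q₁ ^ 2 + q₂ ^ 2 ∧ q₀ ^ 2 + q₁ ^ 2 + q₂ ^ 2 ≤ 2601 / 2500) :
    (43 / 100 ≤ q₂ ∧ q₂ ≤ 143 / 250) ∧ (79 / 100 ≤ q₀ ∧ q₀ ≤ 37 / 40) := by
  subst hq1
  obtain ⟨hp1, hp2⟩ := hp
  obtain ⟨hpq1, hpq2⟩ := hpq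
  obtain ⟨hqq1, hqq2⟩ := hqq
  have hq2 : 43 / 100 ≤ q₂ ∧ q₂ ≤ 143 / 250 := ⟨by nlinarith, by nlinarith⟩
  refine ⟨hq2, ?_, ?_⟩
  · nlinarith [hq2.1, hq2.2]
  · nlinarith [hq2.1, hq2.2]

/-- **Coordinate bounds for a common neighbour.** In the frame, a point `w = (w₀, w₁, w₂)` in
the three windows `⟪p, w⟫ = p₂ w₂`, `⟪q, w⟫ = q₀ w₀ + q₂ w₂ ∈ [0.4402, 0.5602]`,
`‖w‖² ∈ [0.9604, 1.0404]` has `w₂ ∈ [0.43, 0.572]`, `w₀ ∈ [0.12, 0.48]`, `w₁² ∈ [0.4, 0.85]`.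
[folklore] -/
private theorem coord_bounds {p₂ q₀ q₂ w₀ w₁ w₂ : ℝ} (hp : 1 - 1 / 50 ≤ p₂ ∧ p₂ ≤ 1 + 1 / 50)
    (hq2 : 43 / 100 ≤ q₂ ∧ q₂ ≤ 143 / 250) (hq0 : 79 / 100 ≤ q₀ ∧ q₀ ≤ 37 / 40)
    (hpw : 2201 / 5000 ≤ p₂ * w₂ ∧ p₂ * w₂ ≤ 2801 / 5000)
    (hqw : 2201 / 5000 ≤ q₀ * w₀ + q₂ * w₂ ∧ q₀ * w₀ + q₂ * w₂ ≤ 2801 / 5000)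
    (hww : 2401 / 2500 ≤ w₀ ^ 2 + w₁ ^ 2 + w₂ ^ 2 ∧ w₀ ^ 2 + w₁ ^ 2 + w₂ ^ 2 ≤ 2601 / 2500) :
    (43 / 100 ≤ w₂ ∧ w₂ ≤ 143 / 250) ∧ (3 / 25 ≤ w₀ ∧ w₀ ≤ 12 / 25) ∧
      (2 / 5 ≤ w₁ ^ 2 ∧ w₁ ^ 2 ≤ 17 / 20) := by
  obtain ⟨hp1, hp2⟩ := hp
  obtain ⟨hq21, hq22⟩ := hq2
  obtain ⟨hq01, hq02⟩ := hq0
  obtain ⟨hpw1, hpw2⟩ := hpw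
  obtain ⟨hqw1, hqw2⟩ := hqw
  obtain ⟨hww1, hww2⟩ := hww
  have hw2 : 43 / 100 ≤ w₂ ∧ w₂ ≤ 143 / 250 := ⟨by nlinarith, by nlinarith⟩
  obtain ⟨hw21, hw22⟩ := hw2
  -- the mixed term `q₂ w₂`
  have hm1 : (43 / 100) ^ 2 ≤ q₂ * w₂ := by nlinarith [mul_nonneg (sub_nonneg.2 hq21) (sub_nonneg.2 hw21)]
  have hm2 : q₂ * w₂ ≤ (143 / 250) ^ 2 := by
    nlinarith [mul_nonneg (sub_nonneg.2 hq21) (sub_nonneg.2 hw22)]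
  -- hence `q₀ w₀`, hence `w₀`
  have hw01 : 3 / 25 ≤ w₀ := by nlinarith
  have hw02 : w₀ ≤ 12 / 25 := by nlinarith
  refine ⟨⟨hw21, hw22⟩, ⟨hw01, hw02⟩, ?_, ?_⟩
  · nlinarith [mul_nonneg (sub_nonneg.2 hw02) (add_nonneg (by norm_num : (0:ℝ) ≤ 12 / 25) (by linarith : (0:ℝ) ≤ w₀)),
      mul_nonneg (sub_nonneg.2 hw22) (add_nonneg (by norm_num : (0:ℝ) ≤ 143 / 250) (by linarith : (0:ℝ) ≤ w₂))]
  · nlinarith [mul_nonneg (sub_nonneg.2 hw01) (sub_nonneg.2 hw01),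
      mul_nonneg (sub_nonneg.2 hw21) (sub_nonneg.2 hw21)]

/-- **Two same-side common neighbours are close.** Two points in the coordinate box of
`coord_bounds` whose middle coordinates have the same sign are at squared distance
`≤ 0.36² + 0.3² + 0.142² < 0.98²`. [folklore] -/
private theorem same_side {x₀ x₁ x₂ y₀ y₁ y₂ : ℝ}
    (hx : (43 / 100 ≤ x₂ ∧ x₂ ≤ 143 / 250) ∧ (3 / 25 ≤ x₀ ∧ x₀ ≤ 12 / 25) ∧
      (2 / 5 ≤ x₁ ^ 2 ∧ x₁ ^ 2 ≤ 17 / 20))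
    (hy : (43 / 100 ≤ y₂ ∧ y₂ ≤ 143 / 250) ∧ (3 / 25 ≤ y₀ ∧ y₀ ≤ 12 / 25) ∧
      (2 / 5 ≤ y₁ ^ 2 ∧ y₁ ^ 2 ≤ 17 / 20))
    (hs : 0 ≤ x₁ ∧ 0 ≤ y₁ ∨ x₁ ≤ 0 ∧ y₁ ≤ 0) :
    (x₀ - y₀) ^ 2 + (x₁ - y₁) ^ 2 + (x₂ - y₂) ^ 2 < (1 - 1 / 50) ^ 2 := by
  obtain ⟨⟨hx21, hx22⟩, ⟨hx01, hx02⟩, ⟨hx11, hx12⟩⟩ := hx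
  obtain ⟨⟨hy21, hy22⟩, ⟨hy01, hy02⟩, ⟨hy11, hy12⟩⟩ := hy
  have h0 : (x₀ - y₀) ^ 2 ≤ (9 / 25) ^ 2 := by
    nlinarith [mul_nonneg (sub_nonneg.2 hx01) (sub_nonneg.2 hy02),
      mul_nonneg (sub_nonneg.2 hx02) (sub_nonneg.2 hy01)]
  have h2 : (x₂ - y₂) ^ 2 ≤ (71 / 500) ^ 2 := by
    nlinarith [mul_nonneg (sub_nonneg.2 hx21) (sub_nonneg.2 hy22),
      mul_nonneg (sub_nonneg.2 hx22) (sub_nonneg.2 hy21)]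
  have h1 : (x₁ - y₁) ^ 2 ≤ (3 / 10) ^ 2 := by
    rcases hs with ⟨hsx, hsy⟩ | ⟨hsx, hsy⟩
    · have hx' : 63 / 100 ≤ x₁ ∧ x₁ ≤ 93 / 100 := ⟨by nlinarith, by nlinarith⟩
      have hy' : 63 / 100 ≤ y₁ ∧ y₁ ≤ 93 / 100 := ⟨by nlinarith, by nlinarith⟩
      nlinarith [mul_nonneg (sub_nonneg.2 hx'.1) (sub_nonneg.2 hy'.2),
        mul_nonneg (sub_nonneg.2 hx'.2) (sub_nonneg.2 hy'.1)]
    · have hx' : 63 / 100 ≤ -x₁ ∧ -x₁ ≤ 93 / 100 := ⟨by nlinarith, by nlinarith⟩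
      have hy' : 63 / 100 ≤ -y₁ ∧ -y₁ ≤ 93 / 100 := ⟨by nlinarith, by nlinarith⟩
      nlinarith [mul_nonneg (sub_nonneg.2 hx'.1) (sub_nonneg.2 hy'.2),
        mul_nonneg (sub_nonneg.2 hx'.2) (sub_nonneg.2 hy'.1)]
  nlinarith [h0, h1, h2]

/-- **The framed statement.** `stub_commonNbrLeTwo` for five points already in the frame
`P = (0, 0, ‖P‖)`, `Q = (Q₀, 0, Q₂)` with `Q₀ ≥ 0`, `X₁ ≥ 0`: the coordinate boxes of
`coord_bounds` for `X, Y, Z` and the pigeonhole on the signs of `X₁, Y₁, Z₁`. [folklore] -/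
private theorem framed (P Q X Y Z : EuclideanSpace ℝ (Fin 3))
    (hP0 : P 0 = 0) (hP1 : P 1 = 0) (hP2 : P 2 = ‖P‖) (hQ1 : Q 1 = 0) (hQ0 : 0 ≤ Q 0)
    (hX1 : 0 ≤ X 1)
    (hp : 1 - 1 / 50 ≤ ‖P‖ ∧ ‖P‖ ≤ 1 + 1 / 50) (hq : 1 - 1 / 50 ≤ ‖Q‖ ∧ ‖Q‖ ≤ 1 + 1 / 50)
    (hx : 1 - 1 / 50 ≤ ‖X‖ ∧ ‖X‖ ≤ 1 + 1 / 50) (hy : 1 - 1 / 50 ≤ ‖Y‖ ∧ ‖Y‖ ≤ 1 + 1 / 50)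
    (hz : 1 - 1 / 50 ≤ ‖Z‖ ∧ ‖Z‖ ≤ 1 + 1 / 50)
    (hpq : 1 - 1 / 50 ≤ dist P Q ∧ dist P Q ≤ 1 + 1 / 50)
    (hpx : 1 - 1 / 50 ≤ dist P X ∧ dist P X ≤ 1 + 1 / 50)
    (hqx : 1 - 1 / 50 ≤ dist Q X ∧ dist Q X ≤ 1 + 1 / 50)
    (hpy : 1 - 1 / 50 ≤ dist P Y ∧ dist P Y ≤ 1 + 1 / 50)
    (hqy : 1 - 1 / 50 ≤ dist Q Y ∧ dist Q Y ≤ 1 + 1 / 50)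
    (hpz : 1 - 1 / 50 ≤ dist P Z ∧ dist P Z ≤ 1 + 1 / 50)
    (hqz : 1 - 1 / 50 ≤ dist Q Z ∧ dist Q Z ≤ 1 + 1 / 50)
    (hxy : 1 - 1 / 50 ≤ dist X Y) (hyz : 1 - 1 / 50 ≤ dist Y Z) (hxz : 1 - 1 / 50 ≤ dist X Z) :
    False := by
  -- the windows in coordinates
  have ipq := inner_window hp hq hpq
  have ipx := inner_window hp hx hpx
  have ipy := inner_window hp hy hpy
  have ipz := inner_window hp hz hpz
  rw [inner_fin3, hP0, hP1, hP2] at ipq ipx ipy ipz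
  have iqx := inner_window hq hx hqx
  have iqy := inner_window hq hy hqy
  have iqz := inner_window hq hz hqz
  rw [inner_fin3, hQ1] at iqx iqy iqz
  have nq := sq_window hq
  have nx := sq_window hx
  have ny := sq_window hy
  have nz := sq_window hz
  rw [norm_sq_fin3] at nq nx ny nz
  -- the frame numbers and the three coordinate boxes
  obtain ⟨hq2, hq0⟩ := frame_bounds (p₂ := ‖P‖) (q₀ := Q 0) (q₁ := Q 1) (q₂ := Q 2) hp hQ0 hQ1
    ⟨by linarith only [ipq.1], by linarith only [ipq.2]⟩ nq
  have bx := coord_bounds (w₀ := X 0) (w₁ := X 1) (w₂ := X 2) hp hq2 hq0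
    ⟨by linarith only [ipx.1], by linarith only [ipx.2]⟩
    ⟨by linarith only [iqx.1], by linarith only [iqx.2]⟩ nx
  have bY := coord_bounds (w₀ := Y 0) (w₁ := Y 1) (w₂ := Y 2) hp hq2 hq0
    ⟨by linarith only [ipy.1], by linarith only [ipy.2]⟩
    ⟨by linarith only [iqy.1], by linarith only [iqy.2]⟩ ny
  have bz := coord_bounds (w₀ := Z 0) (w₁ := Z 1) (w₂ := Z 2) hp hq2 hq0
    ⟨by linarith only [ipz.1], by linarith only [ipz.2]⟩
    ⟨by linarith only [iqz.1], by linarith only [iqz.2]⟩ nz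
  -- squared separations
  have dxy := pow_le_pow_left₀ (by norm_num : (0 : ℝ) ≤ 1 - 1 / 50) hxy 2
  have dyz := pow_le_pow_left₀ (by norm_num : (0 : ℝ) ≤ 1 - 1 / 50) hyz 2
  have dxz := pow_le_pow_left₀ (by norm_num : (0 : ℝ) ≤ 1 - 1 / 50) hxz 2
  rw [dist_sq_fin3] at dxy dyz dxz
  -- pigeonhole on the sides
  rcases le_total 0 (Y 1) with hY1 | hY1
  · linarith only [same_side bx bY (Or.inl ⟨hX1, hY1⟩), dxy]
  rcases le_total 0 (Z 1) with hZ1 | hZ1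
  · linarith only [same_side bx bz (Or.inl ⟨hX1, hZ1⟩), dxz]
  · linarith only [same_side bY bz (Or.inr ⟨hY1, hZ1⟩), dyz]

/-- **A bond has at most two common bonded neighbours** (census half of the shell trichotomy):
there are no three points `x, y, z` of `ℝ³`, pairwise `≥ 0.98` apart, each within the bond
window `[0.98, 1.02]` of `0` (norm), of `p` and of `q`, where `0, p, q` is itself a bond
triangle.  After the frame normalisation `p = (0, 0, ‖p‖)`, `q = (q₀, 0, q₂)`
(`ShellCensus.exists_frame`) the common neighbours of the bond `pq` are confined to two blobs of
diameter `< 0.49` on the two sides of the plane through `0, p, q`; two of `x, y, z` lie on the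
same side (pigeonhole) and are then closer than `0.98`. [folklore] -/
theorem stub_commonNbrLeTwo (p q x y z : EuclideanSpace ℝ (Fin 3))
    (hp : 1 - 1 / 50 ≤ ‖p‖ ∧ ‖p‖ ≤ 1 + 1 / 50) (hq : 1 - 1 / 50 ≤ ‖q‖ ∧ ‖q‖ ≤ 1 + 1 / 50)
    (hx : 1 - 1 / 50 ≤ ‖x‖ ∧ ‖x‖ ≤ 1 + 1 / 50) (hy : 1 - 1 / 50 ≤ ‖y‖ ∧ ‖y‖ ≤ 1 + 1 / 50)
    (hz : 1 - 1 / 50 ≤ ‖z‖ ∧ ‖z‖ ≤ 1 + 1 / 50)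
    (hpq : 1 - 1 / 50 ≤ dist p q ∧ dist p q ≤ 1 + 1 / 50)
    (hpx : 1 - 1 / 50 ≤ dist p x ∧ dist p x ≤ 1 + 1 / 50) (hqx : 1 - 1 / 50 ≤ dist q x ∧ dist q x ≤ 1 + 1 / 50)
    (hpy : 1 - 1 / 50 ≤ dist p y ∧ dist p y ≤ 1 + 1 / 50) (hqy : 1 - 1 / 50 ≤ dist q y ∧ dist q y ≤ 1 + 1 / 50)
    (hpz : 1 - 1 / 50 ≤ dist p z ∧ dist p z ≤ 1 + 1 / 50) (hqz : 1 - 1 / 50 ≤ dist q z ∧ dist q z ≤ 1 + 1 / 50)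
    (hxy : 1 - 1 / 50 ≤ dist x y) (hyz : 1 - 1 / 50 ≤ dist y z) (hxz : 1 - 1 / 50 ≤ dist x z) : False := by
  obtain ⟨A, hA⟩ :=
    ShellCensus.exists_frame (id : EuclideanSpace ℝ (Fin 3) → EuclideanSpace ℝ (Fin 3)) p q x
  dsimp only [id_eq] at hA
  obtain ⟨hP0, hP1, hP2, hQ1, hQ0, hX1⟩ := hA
  exact framed (A p) (A q) (A x) (A y) (A z) hP0 hP1 (by rw [hP2, A.norm_map]) hQ1 hQ0 hX1
    (by rwa [A.norm_map]) (by rwa [A.norm_map]) (by rwa [A.norm_map]) (by rwa [A.norm_map])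
    (by rwa [A.norm_map]) (by rwa [A.dist_map]) (by rwa [A.dist_map]) (by rwa [A.dist_map])
    (by rwa [A.dist_map]) (by rwa [A.dist_map]) (by rwa [A.dist_map]) (by rwa [A.dist_map])
    (by rwa [A.dist_map]) (by rwa [A.dist_map]) (by rwa [A.dist_map])

end Summit.AtomisticToContinuum.Crystallization.Theorems

end
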